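import Literature.Analysis.FluidPDE.TypeIAncientMild
import Literature.Analysis.FluidPDE.OseenMildUniqueness
import Summits.NavierStokesRegularity.NavierStokesRegularity.Theorems.SymmetricLiouville.Negative.SmallConstantGap
import HarnessLib

/-!
# Stub A2 of line `blowdown-kills-pitch` of crux `SymmetricLiouville`: small at `−∞` forces zero

Crux stmt-NavierStokesRegularity-4053, route `SymmetryModuliCount`.

For every element `u` of the Type-I moduli class `A_C = IsTypeIAncientMild C` (smooth, divergence
free, KNSS/Oseen-mild between all pairs `s < t < 0`, `‖u(t,x)‖ ≤ C/√(−t)`; NO symmetry), if the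
scale-invariant size `√(−t)‖u(t,x)‖` is small near `t = −∞` then `u ≡ 0` on the whole past.

Proof = two tree engines glued.

* BACKWARD HALF (`exists_vanishes_before`): the landed gap theorem
  `Negative.exists_eps_small_vanishes` (`∃ ε₀ > 0`, every element of `A_C` with
  `√(−t)‖u‖ ≤ ε₀` throughout vanishes) applied to the backward time shift `v = u(· + T) ∈ A_C`
  (`IsTypeIAncientMild.comp_sub_right`), where `T < 0` is the time before which
  `√(−t)‖u(t,x)‖ ≤ ε₀`; monotonicity `√(−t) ≤ √(−(t+T))` transfers the smallness to `v`, so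
  `u ≡ 0` on `t < T`.
* FORWARD HALF (`vanishes_of_vanishes_before`): uniqueness of bounded Oseen-mild solutions
  (`oseenMild_bounded_unique`) on the slab `(T − 1, t₁/2)` with the vanishing free term
  `e^{(t−s)Δ}u(s) = 0` (`s = T − 1`), comparing `u` with the zero solution; the a.e. identity
  `u(t₁) = 0` is upgraded to a pointwise one by continuity of the slice.
-/

noncomputable section

set_option linter.dupNamespace false

open Set Function Filter MeasureTheory
open scoped Topology
open Literature.Analysis Literature.Analysis.FluidPDE

namespace Summit.NavierStokesRegularity.NavierStokesRegularity.Theorems.SymmetryModuliCountSymmetricLiouville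

/-- Local notation for physical space `ℝ³`. -/
local notation "E3" => EuclideanSpace ℝ (Fin 3)

open Summit.NavierStokesRegularity.NavierStokesRegularity.Theorems.SymmetricLiouville.Negative in
/-- **Backward half.** If `u ∈ A_C` has `√(−t)‖u(t,x)‖ → 0` uniformly as `t → −∞`, then `u`
vanishes identically before some negative time `T`: the gap theorem
`Negative.exists_eps_small_vanishes` applied to the backward shift `u(· + T) ∈ A_C`. -/
theorem exists_vanishes_before {C : ℝ} {u : ℝ → E3 → E3} (h : IsTypeIAncientMild C u)
    (hsmall : ∀ ε > 0, ∃ T < 0, ∀ t < T, ∀ x, Real.sqrt (-t) * ‖u t x‖ ≤ ε) :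
    ∃ T < 0, ∀ t < T, ∀ x, u t x = 0 := by
  obtain ⟨ε₀, hε₀, hgap⟩ := exists_eps_small_vanishes
  obtain ⟨T, hT, hTε⟩ := hsmall ε₀ hε₀
  -- the backward shift `v t = u (t + T)` is again in the class
  have hv : IsTypeIAncientMild C (fun t => u (t - -T)) := h.comp_sub_right (by linarith)
  have hvin : InClass C (fun t => u (t - -T)) := isTypeIAncientMild_iff.1 hv
  have hvz : VanishesOnPast (fun t => u (t - -T)) := by
    refine hgap C _ hvin fun t ht x => ?_
    have htT : t - -T < T := by linarith
    calc Real.sqrt (-t) * ‖u (t - -T) x‖ ≤ Real.sqrt (-(t - -T)) * ‖u (t - -T) x‖ :=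
          mul_le_mul_of_nonneg_right (Real.sqrt_le_sqrt (by linarith)) (norm_nonneg _)
      _ ≤ ε₀ := hTε _ htT x
  refine ⟨T, hT, fun t ht x => ?_⟩
  have key := hvz (t - T) (by linarith) x
  simp only [sub_neg_eq_add, sub_add_cancel] at key
  exact key

/-- **Forward half.** If `u ∈ A_C` vanishes identically before some negative time `T`, then it
vanishes on the whole past: on the slab `(T − 1, t₁/2) × ℝ³` both `u` and `0` are bounded, jointly
measurable solutions of the Oseen integral equation with the same (vanishing) free term
`e^{(t−s)Δ}u(s)`, `s = T − 1`, so they agree a.e. at `t₁` (`oseenMild_bounded_unique`), hence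
everywhere by continuity of the slice `u(t₁)`. -/
theorem vanishes_of_vanishes_before {C T : ℝ} {u : ℝ → E3 → E3} (h : IsTypeIAncientMild C u)
    (hT : T < 0) (hz : ∀ t < T, ∀ x, u t x = 0) : ∀ t < 0, ∀ x, u t x = 0 := by
  intro t₁ ht₁ x
  by_cases hlt : t₁ < T
  · exact hz t₁ hlt x
  rw [not_lt] at hlt
  -- the slab `(s, T') = (T - 1, t₁ / 2)`
  have hs0 : ∀ y, u (T - 1) y = 0 := hz (T - 1) (by linarith)
  have hsT' : T - 1 < t₁ / 2 := by linarith
  have hT'0 : t₁ / 2 < 0 := by linarith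
  have ht₁I : t₁ ∈ Ioo (T - 1) (t₁ / 2) := ⟨by linarith, by linarith⟩
  have hM : 0 ≤ C / Real.sqrt (-(t₁ / 2)) := div_nonneg h.nonneg (Real.sqrt_nonneg _)
  have huM : ∀ τ ∈ Ioo (T - 1) (t₁ / 2), ∀ y, ‖u τ y‖ ≤ C / Real.sqrt (-(t₁ / 2)) :=
    fun τ hτ y => h.norm_le_of_mem_Ioo hT'0 hτ y
  have hvM : ∀ τ ∈ Ioo (T - 1) (t₁ / 2), ∀ y : E3,
      ‖(0 : ℝ → E3 → E3) τ y‖ ≤ C / Real.sqrt (-(t₁ / 2)) := fun τ _ y => by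
    simpa only [Pi.zero_apply, norm_zero] using hM
  have hum := h.aestronglyMeasurable_uncurry (s := T - 1) hT'0.le
  have hvm : AEStronglyMeasurable (uncurry (0 : ℝ → E3 → E3))
      ((volume : Measure (ℝ × E3)).restrict (Ioo (T - 1) (t₁ / 2) ×ˢ univ)) :=
    aestronglyMeasurable_const
  -- the two integral equations with the free term `e^{(t-s)Δ} u(s) = 0`
  have hu : ∀ t ∈ Ioo (T - 1) (t₁ / 2), u t =ᵐ[volume] fun y =>
      UnboundedOperators.heatExtension (u (T - 1)) (t - (T - 1)) y -
        oseenDuhamel 1 (T - 1) u u t y :=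
    fun t ht => Eventually.of_forall fun y => h.mild_eq_heatExtension ht.1 (ht.2.trans hT'0) y
  have hv : ∀ t ∈ Ioo (T - 1) (t₁ / 2), (0 : ℝ → E3 → E3) t =ᵐ[volume] fun y =>
      UnboundedOperators.heatExtension (u (T - 1)) (t - (T - 1)) y -
        oseenDuhamel 1 (T - 1) (0 : ℝ → E3 → E3) (0 : ℝ → E3 → E3) t y := by
    intro t ht
    refine Eventually.of_forall fun y => ?_
    have e0 : u (T - 1) = fun _ => (0 : E3) := funext hs0
    rw [oseenDuhamel_zero_left, e0]
    simp only [Pi.zero_apply, sub_zero]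
    rw [UnboundedOperators.heatExtension_const _ (sub_pos.2 ht.1)]
  have key := oseenMild_bounded_unique one_pos hM hum hvm huM hvM hu hv t₁ ht₁I
  have heq := (Continuous.ae_eq_iff_eq volume (h.continuous_slice ht₁) continuous_const).1 key
  simpa using congr_fun heq x

/-- **Stub 4 — A2, SMALL AT `−∞` ⇒ ZERO (Kato gap + forward uniqueness; no symmetry).** For every
`u ∈ A_C`: if `√(−t)‖u(t,x)‖ ≤ ε` for all `x` and all `t < T(ε) < 0`, for every `ε > 0`, then
`u ≡ 0` on `t < 0`. Engine: the landed gap theorem `Negative.exists_eps_small_vanishes` on the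
backward shift `u(· + T) ∈ A_C` (`exists_vanishes_before`), then `oseenMild_bounded_unique`
forward (`vanishes_of_vanishes_before`). -/
theorem stub_smallAtMinusInfinityLiouville :
    ∀ (C : ℝ) (u : ℝ → E3 → E3), IsTypeIAncientMild C u →
      (∀ ε > 0, ∃ T < 0, ∀ t < T, ∀ x, Real.sqrt (-t) * ‖u t x‖ ≤ ε) →
      ∀ t < 0, ∀ x, u t x = 0 := by
  intro C u h hsmall
  obtain ⟨T, hT, hz⟩ := exists_vanishes_before h hsmall
  exact vanishes_of_vanishes_before h hT hz

end Summit.NavierStokesRegularity.NavierStokesRegularity.Theorems.SymmetryModuliCountSymmetricLiouville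

end
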